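import Summits.ResolutionOfSingularities.ResolutionOfSingularities.Theorems.EquisingularLiftEquisingularLiftNatTowerInvTwoPointCentre
import Summits.ResolutionOfSingularities.ResolutionOfSingularities.Theorems.EquisingularLiftEquisingularLiftNatTowerReachTwoDefs
import HarnessLib

/-!
# [OURS · L1 W4.5(b) · EL♮(3)] Rung TOWER₂, brick `towerPtRam_brick` part 4 — THE (pt-ram) CLAUSE OF THE DRIVER AT `INV₁ := Tower.Inv₂`:
# `Tower.towerPtRam₂_inv₂ : TowerPtRam₂ F₉ F₁₀ υ' (Tower.Inv₂ … Ruled F₉ Z₉ hZ₉ F₁₀ υ')` modulo the ruled-datum transport hypothesis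
# (crux `EquisingularLiftNatThree` = stmt-ResolutionOfSingularities-20148, parent `EquisingularLiftNat` = stmt-…-20038; registered stub
# `stub_elnat_coneTowerPointResolution`; constructor `TowerPtRam₂` of res-L1-w45b-lead-2's …NatTowerReachTwoDefs (RULING-6 as amended);
# invariant `Tower.Inv₂` of res-D-pv-029's …NatTowerInvDefs v2 p556392)

HONEST FRAMING. OURS (cell res-hironaka, crux chain w45b, slot W4.5(b)); NOT a statement of any manuscript; AI-written, weaker than expert
review. Helper `--supports stmt-ResolutionOfSingularities-20148 --as helper`; closes nothing; no `sorry`; standard axioms; DEF-FREE.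
res-L1-w45b-stub-4, object `towerPtRam_brick` (res-L1-w45b-plan-1 NAMING 2026-08-27T16:37:19Z (a)). Parts 1–3: p550227 · p552505 · p555772;
the centre-agnostic `Tower.Inv₂` point step: …NatTowerInvTwoPointCentre.

WHAT. `Tower.inv₂_ptRam_new` / `Tower.inv₂_ptRam_transport` / `Tower.inv₂_ptRam_forget` = res-L1-w45b-stub-2's `fatPointStep` with the
bookkeeping (`fatPointStep_model`, part 2) fed into the centre-agnostic lemmas; **`Tower.towerPtRam₂_inv₂`** = the case split over the
`TowerPtRam₂` menus — `E′ = υ₂⁻¹{y}` (new plane, any `K′`) · `E′ = closure υ₂⁻¹(E∖{y})` under «`((γ ≫ υ′) '' E).Finite ∨ y ∉ E`» with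
`K′ = ∅` (forget) or `K′ = closure υ₂⁻¹(K∖{y})` under `y ∉ closure K` (transport) — i.e. THE (pt-ram) HYPOTHESIS of res-D-pv-029's driver
`hsub_reachTower₂_of_invariant` at `INV₁ := Tower.Inv₂ O k θ P q Y Ch Ruled`, modulo the single stand-in `hRuled` (interface
`ruled_of_step_away`, adopted by the assembly 18:39:54Z; discharged by the root-plus-iso `Ruled` once res-L1-w45b-stub-2 / res-type-027 define it).
The `¬ IsRegularLocalRing (G.presheaf.stalk y)` binder of `TowerPtRam₂` is not used.

References: Q. Liu (2002), §8.1, Thm. 8.1.19; U. Görtz, T. Wedhorn (2020), Prop. 13.91 (3), (13.19); The Stacks Project, Tags 02OS, 033B, 0805, 01WS —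
through the cited tree files. OURS planning texts (index only): res-L1-w45b-plan-1 18:27:13Z, res-L1-w45b-lead-2 18:31:42Z, res-D-pv-029 18:33:04Z / 18:39:54Z.
-/

set_option linter.dupNamespace false -- mandated namespace `Summit.<Summit>.<Problem>` of this single-conjunct summit
set_option linter.overlappingInstances false -- the binders carry `[IsDomain O] [IsDiscreteValuationRing O]`

noncomputable section

open CategoryTheory CategoryTheory.Limits AlgebraicGeometry TopologicalSpace Topology IsLocalRing
open Literature.AlgebraicGeometry.Resolution
open AlgebraicGeometry.Scheme.IdealSheafData
open Summit.ResolutionOfSingularities.ResolutionOfSingularities.Theses.EquisingularLift.Split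

namespace Summit.ResolutionOfSingularities.ResolutionOfSingularities.Cruxes.EquisingularLiftNat.Sections

section PtRamTwo

variable (O : Type) [CommRing O] [IsDomain O] [IsDiscreteValuationRing O] [IsAdicComplete (maximalIdeal O) O]
  [IsAlgClosed (ResidueField O)] (k : Type) [Field k] (θ : O →+* k) (hθ : Function.Surjective θ)
  (P : Scheme.{0}) (q : P ⟶ Spec (.of O)) (Y : Set P) (hYsp : Y ⊆ q ⁻¹' {closedPoint O}) (hYirr : IsIrreducible Y)
  (hYcl : IsClosed Y) [IsProper q] [IsIntegral P] (hPnoeth : IsLocallyNoetherian P) (hPreg : Scheme.IsRegular P)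
  (n : ℕ) [SmoothOfRelativeDimension n q]
  (Ch : ∀ X' : Scheme.{0}, (X' ⟶ P) → Set X' → Prop)
  (hChain : ∀ (X' : Scheme.{0}) (σ : X' ⟶ P) (S : Set X'), Ch X' σ S → Chain P Y X' σ S)
  (hStep : ∀ (X' X'' : Scheme.{0}) (σ' : X' ⟶ P) (S' : Set X') (C : X'.IdealSheafData) (τ : X'' ⟶ X'),
    Ch X' σ' S' → IsBlowup τ C → Scheme.IsRegular C.subscheme → Flat (C.subschemeι ≫ σ' ≫ q) →
    σ' '' (C.support : Set X') ⊆ {x : P | ¬ IsGenericPoint x Y} →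
    (C.support : Set X') ∩ (σ' ≫ q) ⁻¹' {closedPoint O} ⊆ S' →
    Ch X'' (τ ≫ σ') (closure (τ ⁻¹' (S' \ (C.support : Set X')))))
  (Ruled : Tower.RuledDatum P)
  {F₉ : Scheme.{0}} {Z₉ : Set F₉} {hZ₉ : IsClosed Z₉} {F₁₀ : Scheme.{0}} {υ' : F₁₀ ⟶ F₉}
  (hRuled : ∀ (G₀ G₀' : Scheme.{0}) (γ₀ : G₀ ⟶ F₁₀) (E₀ : Set G₀) (X₀ X₀'' : Scheme.{0}) (σ₀ : X₀ ⟶ P) (j₀ : G₀ ⟶ X₀)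
      (j₀' : G₀' ⟶ X₀'') (t₀' : G₀' ⟶ Spec (.of k)) (𝓔₀ : X₀.IdealSheafData) (τ₀ : X₀'' ⟶ X₀) (υ₀ : G₀' ⟶ G₀) (y₀ : G₀),
    j₀' ≫ τ₀ = υ₀ ≫ j₀ → IsPullback j₀' t₀' ((τ₀ ≫ σ₀) ≫ q) (Spec.map (CommRingCat.ofHom θ)) → y₀ ∉ E₀ →
    (∃ e : (𝓔₀.comap τ₀).subscheme ≅ 𝓔₀.subscheme, e.hom ≫ 𝓔₀.subschemeι = (𝓔₀.comap τ₀).subschemeι ≫ τ₀) →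
    Ruled F₉ Z₉ hZ₉ F₁₀ υ' G₀ γ₀ E₀ X₀ σ₀ j₀ 𝓔₀ →
    Ruled F₉ Z₉ hZ₉ F₁₀ υ' G₀' (υ₀ ≫ γ₀) (closure (υ₀ ⁻¹' (E₀ \ {y₀}))) X₀'' (τ₀ ≫ σ₀) j₀' (𝓔₀.comap τ₀))
  {G G' : Scheme.{0}} {γ : G ⟶ F₁₀} {T E K : Set G}
  (y : redSub G (closure T) isClosed_closure) (J : G.IdealSheafData) (υ₂ : G' ⟶ G)
  (hinv : Tower.Inv₂ O k θ P q Y Ch Ruled F₉ Z₉ hZ₉ F₁₀ υ' G γ T E K)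
  (hTreg : ¬ IsRegularLocalRing ((redSub G (closure T) isClosed_closure).presheaf.stalk y))
  (hJsupp : (J.support : Set G) = {curvePt G T y})
  (hJgen : ∃ (ℓ : Fin n → G.presheaf.stalk (curvePt G T y))
      (hℓ : ∀ i, ℓ i ∈ maximalIdeal (G.presheaf.stalk (curvePt G T y))),
    stalkIdeal J (curvePt G T y) = Ideal.span (Set.range ℓ) ∧
    LinearIndependent (ResidueField (G.presheaf.stalk (curvePt G T y)))
      (fun i => (maximalIdeal (G.presheaf.stalk (curvePt G T y))).toCotangent ⟨ℓ i, hℓ i⟩))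
  (hυ₂ : IsBlowup υ₂ J)

include hθ hYsp hYirr hYcl hPnoeth hPreg hChain hStep hinv hTreg hJsupp hJgen hυ₂

/-- The shared preamble: the (pt-ram) stage step with its bookkeeping and the inputs of the centre-agnostic lemmas, from `Tower.Inv₂`'s stage.
[cite: Liu2002, §8.1 and Thm. 8.1.19] [OURS · L1 W4.5b · towerPtRam_brick] -/
theorem Tower.exists_ptRam_stage :
    ∃ (X : Scheme.{0}) (σ : X ⟶ P) (jG : G ⟶ X) (C : X.IdealSheafData) (X'' : Scheme.{0}) (τ : X'' ⟶ X)
      (j₂ : G' ⟶ X'') (t₂ : G' ⟶ Spec (.of k)),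
      IsBlowup υ' (vanishingIdeal (⟨Z₉, hZ₉⟩ : Closeds F₉)) ∧ Z₉.Infinite ∧ IsIntegral G ∧ IsIrreducible T ∧ IsClosed E ∧ ¬ T ⊆ E ∧
      (∀ hE : IsClosed E, Tower.Exc₂ O P q Y Ruled Z₉ hZ₉ υ' G γ E hE K X σ jG) ∧
      IsClosed ({curvePt G T y} : Set G) ∧ ¬ T ⊆ {curvePt G T y} ∧ IsLocallyNoetherian G ∧ IsLocallyNoetherian X ∧
      IsLocallyNoetherian X'' ∧ IsBlowup τ C ∧
      (∀ I : X.IdealSheafData, jG (curvePt G T y) ∉ (I.support : Set X) → Disjoint (I.support : Set X) (C.support : Set X)) ∧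
      j₂ ≫ τ = υ₂ ≫ jG ∧ Ch X'' (τ ≫ σ) (closure (τ ⁻¹' ((jG '' T) \ (C.support : Set X)))) ∧ IsIntegral X'' ∧
      Scheme.IsRegular X'' ∧ IsDominant ((τ ≫ σ) ≫ q) ∧ IsPullback j₂ t₂ ((τ ≫ σ) ≫ q) (Spec.map (CommRingCat.ofHom θ)) ∧
      j₂ '' closure (υ₂ ⁻¹' (T \ {curvePt G T y})) = closure (τ ⁻¹' ((jG '' T) \ (C.support : Set X))) ∧ IsIntegral G' ∧
      IsIrreducible (closure (υ₂ ⁻¹' (T \ {curvePt G T y}))) := by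
  classical
  obtain ⟨hυ', hZ₉inf, hGint, hTcl, hTirr, hEcl, hTE, X, σ, S, jG, tG, hCh, hXint, hXnoeth, hXreg, hdom, hsq, hTS, hExc⟩ := hinv
  haveI := hGint
  haveI := hXint
  haveI := hXnoeth
  have hyT : curvePt G T y ∈ T := subschemeι_mem_of_isClosed hTcl y
  have hyc : IsClosed ({curvePt G T y} : Set G) := hJsupp ▸ J.support.isClosed
  have hTy : ¬ T ⊆ {curvePt G T y} := not_subset_singleton_of_not_isRegularLocalRing_stalk y hTreg hyc
  haveI : IsClosedImmersion (Spec.map (CommRingCat.ofHom θ)) := IsClosedImmersion.spec_of_surjective _ hθ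
  haveI hjci : IsClosedImmersion jG := MorphismProperty.IsStableUnderBaseChange.of_isPullback hsq.flip inferInstance
  have hjyc : IsClosed ({jG (curvePt G T y)} : Set X) := by
    simpa only [Set.image_singleton] using hjci.isClosedEmbedding.isClosedMap _ hyc
  have hyoff : ¬ IsGenericPoint (σ (jG (curvePt G T y))) Y :=
    not_isGenericPoint_of_image_eq (hChain _ _ _ hCh) jG hjci.isClosedEmbedding.injective hTS hjyc hTy
  obtain ⟨ℓ, hℓ, hJℓ, hli⟩ := hJgen
  obtain ⟨C, X'', τ, j₂, t₂, hτ, -, -, -, -, hdisj, hCh'', hreg'', hnoeth'', hint'', hdom'', -, -, hGnoeth, hG'int, -, hT'irr,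
      hsq₂, hcomm, hsets⟩ :=
    fatPointStep_model O k θ hθ P q Y hYsp hYirr hYcl hPnoeth hPreg n Ch hChain hStep X σ S hCh hdom G jG tG hsq T hTS
      (curvePt G T y) hyT hTy hyoff J hJsupp ℓ hℓ hJℓ hli G' υ₂ hυ₂
  subst hTS
  exact ⟨X, σ, jG, C, X'', τ, j₂, t₂, hυ', hZ₉inf, hGint, hTirr, hEcl, hTE, hExc, hyc, hTy, hGnoeth, hXnoeth, hnoeth'', hτ, hdisj, hcomm,
    hCh'', hint'', hreg'', hdom'', hsq₂, hsets, hG'int, hT'irr⟩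

/-- **(pt-ram) on `Tower.Inv₂`, NEW PLANE** (any `K′`). [cite: Liu2002, §8.1 and Thm. 8.1.19] [OURS · L1 W4.5b · towerPtRam_brick toward
`stub_elnat_coneTowerPointResolution`; NOT a statement of the manuscript] -/
theorem Tower.inv₂_ptRam_new (K' : Set G') :
    Tower.Inv₂ O k θ P q Y Ch Ruled F₉ Z₉ hZ₉ F₁₀ υ' G' (υ₂ ≫ γ) (closure (υ₂ ⁻¹' (T \ {curvePt G T y})))
      (υ₂ ⁻¹' {curvePt G T y}) K' := by
  obtain ⟨X, σ, jG, C, X'', τ, j₂, t₂, hυ', hZ₉inf, hGint, -, -, -, -, hyc, hTy, hGnoeth, -, hnoeth'', -, -, -, hCh'', hint'', hreg'',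
    hdom'', hsq₂, hsets, hG'int, hT'irr⟩ :=
    Tower.exists_ptRam_stage O k θ hθ P q Y hYsp hYirr hYcl hPnoeth hPreg n Ch hChain hStep Ruled y J υ₂ hinv hTreg hJsupp hJgen hυ₂
  haveI := hGint; haveI := hGnoeth; haveI := hnoeth''; haveI := hint''; haveI := hG'int
  exact Tower.inv₂_pointCentre_new O k θ P q Y Ch Ruled hυ' hZ₉inf hyc hTy hJsupp hυ₂ hCh'' hreg'' hdom'' hsq₂ hsets hT'irr K'

include hRuled in
/-- **(pt-ram) on `Tower.Inv₂`, TRANSPORTED SURFACE, SHADOW CARRIED** (under «`NoRound ∨ y ∉ E`», «`K = ∅ ∨ y ∉ closure K`», `hRuled`).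
[cite: GortzWedhorn2020, Prop. 13.91 (3) and (13.19)] [cite: StacksProject, Tag 033B] [OURS · L1 W4.5b · towerPtRam_brick toward
`stub_elnat_coneTowerPointResolution`; NOT a statement of the manuscript] -/
theorem Tower.inv₂_ptRam_transport (hE : Tower.NoRound υ' G γ E ∨ curvePt G T y ∉ E) (hK : K = ∅ ∨ curvePt G T y ∉ closure K) :
    Tower.Inv₂ O k θ P q Y Ch Ruled F₉ Z₉ hZ₉ F₁₀ υ' G' (υ₂ ≫ γ) (closure (υ₂ ⁻¹' (T \ {curvePt G T y})))
      (closure (υ₂ ⁻¹' (E \ {curvePt G T y}))) (closure (υ₂ ⁻¹' (K \ {curvePt G T y}))) := by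
  obtain ⟨X, σ, jG, C, X'', τ, j₂, t₂, hυ', hZ₉inf, hGint, hTirr, hEcl, hTE, hExc, hyc, hTy, hGnoeth, hXnoeth, hnoeth'', hτ, hdisj,
    hcomm, hCh'', hint'', hreg'', hdom'', hsq₂, hsets, hG'int, hT'irr⟩ :=
    Tower.exists_ptRam_stage O k θ hθ P q Y hYsp hYirr hYcl hPnoeth hPreg n Ch hChain hStep Ruled y J υ₂ hinv hTreg hJsupp hJgen hυ₂
  haveI := hGint; haveI := hGnoeth; haveI := hXnoeth; haveI := hnoeth''; haveI := hint''; haveI := hG'int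
  exact Tower.inv₂_pointCentre_transport O k θ P q Y Ch Ruled hυ' hZ₉inf hTirr hEcl hTE hExc hyc hTy hJsupp hυ₂ hτ hdisj hcomm hCh''
    hreg'' hdom'' hsq₂ hsets hT'irr hRuled hE hK

include hRuled in
/-- **(pt-ram) on `Tower.Inv₂`, TRANSPORTED SURFACE, SHADOW FORGOTTEN.** [cite: GortzWedhorn2020, Prop. 13.91 (3)] [OURS · L1 W4.5b ·
towerPtRam_brick toward `stub_elnat_coneTowerPointResolution`; NOT a statement of the manuscript] -/
theorem Tower.inv₂_ptRam_forget (hE : Tower.NoRound υ' G γ E ∨ curvePt G T y ∉ E) :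
    Tower.Inv₂ O k θ P q Y Ch Ruled F₉ Z₉ hZ₉ F₁₀ υ' G' (υ₂ ≫ γ) (closure (υ₂ ⁻¹' (T \ {curvePt G T y})))
      (closure (υ₂ ⁻¹' (E \ {curvePt G T y}))) ∅ := by
  obtain ⟨X, σ, jG, C, X'', τ, j₂, t₂, hυ', hZ₉inf, hGint, hTirr, hEcl, hTE, hExc, hyc, hTy, hGnoeth, hXnoeth, hnoeth'', hτ, hdisj,
    hcomm, hCh'', hint'', hreg'', hdom'', hsq₂, hsets, hG'int, hT'irr⟩ :=
    Tower.exists_ptRam_stage O k θ hθ P q Y hYsp hYirr hYcl hPnoeth hPreg n Ch hChain hStep Ruled y J υ₂ hinv hTreg hJsupp hJgen hυ₂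
  haveI := hGint; haveI := hGnoeth; haveI := hXnoeth; haveI := hnoeth''; haveI := hint''; haveI := hG'int
  exact Tower.inv₂_pointCentre_forget O k θ P q Y Ch Ruled hυ' hZ₉inf hTirr hEcl hTE hExc hyc hTy hJsupp hυ₂ hτ hdisj hcomm hCh''
    hreg'' hdom'' hsq₂ hsets hT'irr hRuled hE

end PtRamTwo

/-- **THE (pt-ram) CLAUSE OF THE TOWER DRIVER AT `INV₁ := Tower.Inv₂`**: `TowerPtRam₂ F₉ F₁₀ υ' (Tower.Inv₂ O k θ P q Y Ch Ruled F₉ Z₉ hZ₉ F₁₀ υ')`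
modulo the ruled-datum transport hypothesis `hRuled` (see the module docstring). The case split over the `TowerPtRam₂` menus: new plane
(`Tower.inv₂_ptRam_new`), transported surface with the shadow forgotten (`…_forget`) or carried (`…_transport`). [cite: Liu2002, §8.1 and
Thm. 8.1.19] [cite: GortzWedhorn2020, Prop. 13.91 (3) and (13.19)] [OURS · L1 W4.5b · towerPtRam_brick = hypothesis (pt-ram) of res-D-pv-029's
`hsub_reachTower₂_of_invariant` toward `stub_elnat_coneTowerPointResolution` (stmt-ResolutionOfSingularities-20148 / -20038); NOT a statement of
the manuscript] -/
theorem Tower.towerPtRam₂_inv₂ (O : Type) [CommRing O] [IsDomain O] [IsDiscreteValuationRing O] [IsAdicComplete (maximalIdeal O) O]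
    [IsAlgClosed (ResidueField O)] (k : Type) [Field k] (θ : O →+* k) (hθ : Function.Surjective θ)
    (P : Scheme.{0}) (q : P ⟶ Spec (.of O)) (Y : Set P) (hYsp : Y ⊆ q ⁻¹' {closedPoint O}) (hYirr : IsIrreducible Y)
    (hYcl : IsClosed Y) [IsProper q] [IsIntegral P] (hPnoeth : IsLocallyNoetherian P) (hPreg : Scheme.IsRegular P)
    [SmoothOfRelativeDimension 3 q]
    (Ch : ∀ X' : Scheme.{0}, (X' ⟶ P) → Set X' → Prop)
    (hChain : ∀ (X' : Scheme.{0}) (σ : X' ⟶ P) (S : Set X'), Ch X' σ S → Chain P Y X' σ S)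
    (hStep : ∀ (X' X'' : Scheme.{0}) (σ' : X' ⟶ P) (S' : Set X') (C : X'.IdealSheafData) (τ : X'' ⟶ X'),
      Ch X' σ' S' → IsBlowup τ C → Scheme.IsRegular C.subscheme → Flat (C.subschemeι ≫ σ' ≫ q) →
      σ' '' (C.support : Set X') ⊆ {x : P | ¬ IsGenericPoint x Y} →
      (C.support : Set X') ∩ (σ' ≫ q) ⁻¹' {closedPoint O} ⊆ S' →
      Ch X'' (τ ≫ σ') (closure (τ ⁻¹' (S' \ (C.support : Set X')))))
    (Ruled : Tower.RuledDatum P) (F₉ : Scheme.{0}) (Z₉ : Set F₉) (hZ₉ : IsClosed Z₉) (F₁₀ : Scheme.{0}) (υ' : F₁₀ ⟶ F₉)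
    (hRuled : ∀ (G₀ G₀' : Scheme.{0}) (γ₀ : G₀ ⟶ F₁₀) (E₀ : Set G₀) (X₀ X₀'' : Scheme.{0}) (σ₀ : X₀ ⟶ P) (j₀ : G₀ ⟶ X₀)
        (j₀' : G₀' ⟶ X₀'') (t₀' : G₀' ⟶ Spec (.of k)) (𝓔₀ : X₀.IdealSheafData) (τ₀ : X₀'' ⟶ X₀) (υ₀ : G₀' ⟶ G₀) (y₀ : G₀),
      j₀' ≫ τ₀ = υ₀ ≫ j₀ → IsPullback j₀' t₀' ((τ₀ ≫ σ₀) ≫ q) (Spec.map (CommRingCat.ofHom θ)) → y₀ ∉ E₀ →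
      (∃ e : (𝓔₀.comap τ₀).subscheme ≅ 𝓔₀.subscheme, e.hom ≫ 𝓔₀.subschemeι = (𝓔₀.comap τ₀).subschemeι ≫ τ₀) →
      Ruled F₉ Z₉ hZ₉ F₁₀ υ' G₀ γ₀ E₀ X₀ σ₀ j₀ 𝓔₀ →
      Ruled F₉ Z₉ hZ₉ F₁₀ υ' G₀' (υ₀ ≫ γ₀) (closure (υ₀ ⁻¹' (E₀ \ {y₀}))) X₀'' (τ₀ ≫ σ₀) j₀' (𝓔₀.comap τ₀)) :
    TowerPtRam₂ F₉ F₁₀ υ' (Tower.Inv₂ O k θ P q Y Ch Ruled F₉ Z₉ hZ₉ F₁₀ υ') := by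
  intro G G' γ T E K y J υ₂ K' E' hinv hTreg _hGreg hJsupp hJgen hυ₂ hK' hE'
  rcases hE' with rfl | ⟨hside, rfl⟩
  · exact Tower.inv₂_ptRam_new O k θ hθ P q Y hYsp hYirr hYcl hPnoeth hPreg 3 Ch hChain hStep Ruled y J υ₂ hinv hTreg hJsupp hJgen
      hυ₂ K'
  · have hE : Tower.NoRound υ' G γ E ∨ curvePt G T y ∉ E := hside
    rcases hK' with rfl | ⟨hyK, rfl⟩
    · exact Tower.inv₂_ptRam_forget O k θ hθ P q Y hYsp hYirr hYcl hPnoeth hPreg 3 Ch hChain hStep Ruled hRuled y J υ₂ hinv hTreg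
        hJsupp hJgen hυ₂ hE
    · exact Tower.inv₂_ptRam_transport O k θ hθ P q Y hYsp hYirr hYcl hPnoeth hPreg 3 Ch hChain hStep Ruled hRuled y J υ₂ hinv hTreg
        hJsupp hJgen hυ₂ hE (Or.inr hyK)

end Summit.ResolutionOfSingularities.ResolutionOfSingularities.Cruxes.EquisingularLiftNat.Sections

end
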